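import Literature.NumberTheory.Rogawski1990.LocalStableClassesNonsplitTypeTwoNorms   -- ★ (N1) `exists_hermStar_eq_self_det_not_norm` (type (2) non-norm Cartan element)
import Literature.NumberTheory.Rogawski1990.LocalStableClassesNonsplitRankTwo       -- ★ rank-2 frame realisation; ★ Jacobowitz `exists_formCongr_eq_of_det_eq_mul_norm` (via imports)
import Literature.NumberTheory.Rogawski1990.AnisotropicUnitarySemisimple            -- ★ `hermForm_mulVec_mulVec`
import Literature.LinearAlgebra.Matrix.RegularSemisimpleConjClassClosed             -- ★ `exists_units_conj_eq_of_charpoly_eq_of_separable`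
import Literature.LinearAlgebra.Matrix.BlockCentralizerDisjointSpectra              -- ★ `commute_smul_one_add_smul`
import Literature.NumberTheory.Rogawski1990.KottwitzSteinbergUnitaryCM               -- ★ `mem_unitaryGroup_mul_of_commute`
import HarnessLib

/-!
# An elliptic regular rank-2 class OCCURS in the unitary group of EVERY non-degenerate binary hermitian form at a non-split place, and the classes with a given
# separable characteristic polynomial are exactly a local stable class (Rogawski 1990, §3.5 Prop. 3.5.2 (a)(c), §3.8 Prop. 3.8.1 (d), §14.1 «`γ` occurs in `G′`»)

Topic `NumberTheory/Rogawski1990`; namespace `Literature.NumberTheory.Rogawski1990`.  THEOREMS ONLY (no definition, no instance, no notation, no named fact, no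
`sorry`).  Cell `pub/hodgecm-mathlib` (D-0151), crux H413 = `stmt-HodgeConjecture-24833`, floor-2 line «N6nsGerm» (`Cruxes/H413/Lines/F0_P3a_N6nsGerm.lean`, stub
`stub_N6nsS1`), binder `hcnt` (CNT) of ★ `exists_nhds_finsum_side_eq_stableOrbitalIntegralRel_of_compact_dock` (B-p08, `LocalTransferCompactSideJunctionCM` :202–:211); LEAD
F0P3a-plan (g9) WORD T8-120 «(CNT-b) BY NAME», census `B-provers/B-p04/g34/CENSUS-CNTb-CompactSideCount.B-p04g34.md` §2 (n3)(n4)(n5); seat B-p04 (g34).  HONEST LABEL: HC_CM is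
proved only modulo the printed citations until rung 0 closes; this file is unconditional local algebra and pays no printed letter.

THE MATHEMATICS.  `E∕F` quadratic number fields, `v` a finite place of `F` NOT split in `E` (`E_v = Π_{w∣v} E_w` is a field, `σ = c ⊗ 1`), `H, G ∈ M₂(E_v)` `σ`-hermitian with unit
determinant, `γ ∈ U(H)(F_v)`.
* §1 (any field): in the unitary group of an ANISOTROPIC form every eigenvalue has norm one — `h(x,x) = h(γx,γx) = σ(u)u·h(x,x)` and `h(x,x) ≠ 0` — so no element has an
  eigenframe of SPLIT type.
* §2 OCCURRENCE: if `x ∈ Z(γ)` is `⋆`-symmetric with unit, NON-NORM determinant then `γ` occurs in `U(G)(F_v)` for EVERY `G`: either `det G ≡ det H (mod N E_v^×)` and `G = ᵗσ(T) H T`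
  (Jacobowitz, ★ `exists_formCongr_eq_of_det_eq_mul_norm`), or `det G ≡ det(H·x)` (index two, ★ `exists_norm_mul_of_not_exists_norm`) and `γ ∈ U(H·x)` (`x` commutes with `γ`);
  in both cases `T⁻¹ γ T ∈ U(G)` has the characteristic polynomial of `γ`.  The non-norm Cartan element exists for the ELLIPTIC types: type (1) (`γ P = P·diag(u)`, `u₀ ≠ u₁`,
  `σ(uᵢ)uᵢ = 1`) `x = P·diag(r₀, 1)·P⁻¹` with `r₀` a non-norm `σ`-fixed unit (★ `exists_conjLocal_eq_not_exists_norm`, ★ `hermStar_eigenframe_diagonal_eq_self_iff`); type (2)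
  (`χ_γ` rootless in `E_v`) ★ (N1) `exists_hermStar_eq_self_det_not_norm` — the non-triviality of `H¹(F_v, T) → H¹(F_v, U₂) = F_v^×∕N E_v^×` for both elliptic tori
  [Rogawski1990, §3.5 Prop. 3.5.2 (a)(c)], i.e. «the elliptic `γ` occurs in the inner form `G′`» [§14.1 p. 232].
* §3 THE CLASS SET: for `γ` with SEPARABLE characteristic polynomial, `δ ∈ U(G)` is stably conjugate to `γ` iff `χ_δ = χ_γ` (★ `exists_units_conj_eq_of_charpoly_eq_of_separable`
  over the product of fields `E_v`), so `{⟦δ⟧ : χ_δ = χ_γ} = conjClassesIn σ G γ` — the interface set `S(G, γ)` of the (CNT-b) census, counted by ★ `ncard_conjClassesIn_eq_two_rankTwo`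
  (type (1)) ∕ ★ `ncard_conjClassesIn_eq_one_of_irreducible_rankTwo` (type (2)).

## References
* [Rogawski1990] J. D. Rogawski, *Automorphic Representations of Unitary Groups in Three Variables*, Ann. of Math. Stud. 123 (1990), §3.5 Prop. 3.5.2 (a)(c) p. 29, §3.6 p. 31,
  §3.8 Prop. 3.8.1 (d) p. 30, §4.1 (4.1.1) p. 39, §14.1 p. 232.
* [Jacobowitz1962] R. Jacobowitz, *Hermitian forms over local fields*, Amer. J. Math. 84 (1962), §3 Thm. 3.1.
* [Kottwitz1986] R. E. Kottwitz, *Stable trace formula: elliptic singular terms*, Math. Ann. 275 (1986), §7.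
-/

set_option autoImplicit false

noncomputable section

open NumberField IsDedekindDomain Polynomial
open Matrix hiding mem_unitaryGroup_iff
open scoped MatrixGroups

namespace Literature.NumberTheory.Rogawski1990

open Literature.NumberTheory.Automorphic Literature.NumberTheory.QuadraticForms
open Literature.NumberTheory.Automorphic.UnitaryGroup hiding hermForm hermForm_apply hermForm_mulVec
open Literature.AlgebraicGeometry.ShimuraVarieties (unitaryGroup mem_unitaryGroup_iff hermForm)
open Literature.LinearAlgebra.Matrix (exists_units_conj_eq_of_charpoly_eq_of_separable commute_smul_one_add_smul)

/-! ## §1 Anisotropic forms: every eigenvalue of a unitary element has norm one -/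

section Anisotropic

variable {K : Type*} [Field K] (σ : K →+* K) {n : Type*} [Fintype n] [DecidableEq n] (H : Matrix n n K)

/-- **In `U(H)` for ANISOTROPIC `H` every eigenvalue has norm one**: `γ x = u x`, `x ≠ 0` ⟹ `σ(u) u = 1` (`h(x,x) = h(γx, γx) = σ(u) u h(x,x)`, `h(x,x) ≠ 0`).
[cite: Rogawski1990, §3.8 Prop. 3.8.1 (d) p. 30; §14.5 p. 237] -/
theorem map_mul_self_eq_one_of_mulVec_eq_smul_of_anisotropic (hanis : ∀ x : n → K, hermForm σ H x x = 0 → x = 0)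
    {γ : GL n K} (hγ : γ ∈ unitaryGroup σ H) {x : n → K} (hx : x ≠ 0) {u : K} (hγx : γ.val *ᵥ x = u • x) : σ u * u = 1 := by
  have h := hermForm_mulVec_mulVec σ H hγ x x
  rw [hγx] at h
  have e : hermForm σ H (u • x) (u • x) = σ u * u * hermForm σ H x x := by
    have h1 : σ ∘ (u • x) = σ u • (σ ∘ x) := funext fun i => by simp [map_mul]
    simp only [hermForm, Matrix.mulVec_smul, dotProduct_smul, h1, smul_dotProduct, smul_eq_mul]
    ring
  rw [e] at h
  have hxx : hermForm σ H x x ≠ 0 := fun h0 => hx (hanis x h0)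
  have h2 : (σ u * u - 1) * hermForm σ H x x = 0 := by rw [sub_mul, one_mul, h, sub_self]
  rcases mul_eq_zero.1 h2 with h3 | h3
  · exact sub_eq_zero.1 h3
  · exact absurd h3 hxx

/-- **No SPLIT frame in an anisotropic unitary group**: if `γ ∈ U(H)` (`H` anisotropic) has an eigenframe `γ P = P · diag(u)`, then `σ(uᵢ) uᵢ = 1` for every `i`
(the columns of `P` are non-zero eigenvectors). [cite: Rogawski1990, §3.8 Prop. 3.8.1 (d) p. 30; §3.6 p. 31] -/
theorem forall_map_mul_self_eq_one_of_eigenframe_of_anisotropic (hanis : ∀ x : n → K, hermForm σ H x x = 0 → x = 0)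
    {γ : GL n K} (hγ : γ ∈ unitaryGroup σ H) {P : GL n K} {u : n → K} (hP : γ.val * P.val = P.val * diagonal u) (i : n) :
    σ (u i) * u i = 1 := by
  -- the `i`-th column of `P`
  have hcol : γ.val *ᵥ (fun k => P.val k i) = u i • fun k => P.val k i := by
    ext k
    have h := congrFun (congrFun hP k) i
    rw [mul_diagonal] at h
    simp only [Matrix.mulVec, dotProduct, Pi.smul_apply, smul_eq_mul]
    rw [Matrix.mul_apply] at h
    rw [h, mul_comm]
  refine map_mul_self_eq_one_of_mulVec_eq_smul_of_anisotropic σ H hanis hγ ?_ hcol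
  intro h0
  -- a zero column contradicts invertibility of `P`
  have hdet : P.val.det = 0 := Matrix.det_eq_zero_of_column_eq_zero i fun k => congrFun h0 k
  have hPu : IsUnit P.val.det := by
    have h := P.isUnit
    rwa [Matrix.isUnit_iff_isUnit_det] at h
  exact hPu.ne_zero hdet

end Anisotropic

/-! ## §2 Occurrence of an elliptic class in every binary form (non-split place) -/

section Congr

variable {K : Type*} [CommRing K] (σ : K →+* K) {n : Type*} [Fintype n] [DecidableEq n]

/-- **A congruence `ᵗσ(T) H T = G` carries `γ ∈ U(H)` to `T⁻¹ γ T ∈ U(G)` with the same characteristic polynomial.** [cite: Rogawski1990, §3.1 p. 19] -/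
theorem exists_mem_unitaryGroup_charpoly_eq_of_formCongr {H G : Matrix n n K} {T : GL n K} (hT : formCongr σ T H = G) {γ : GL n K} (hγ : γ ∈ unitaryGroup σ H) :
    ∃ B : GL n K, B ∈ unitaryGroup σ G ∧ B.val.charpoly = γ.val.charpoly := by
  refine ⟨T⁻¹ * γ * T, ?_, ?_⟩
  · rw [mem_unitaryGroup_iff] at hγ ⊢
    rw [← hT]
    show ((T⁻¹ * γ * T).val.map σ)ᵀ * ((T.val.map σ)ᵀ * H * T.val) * (T⁻¹ * γ * T).val = (T.val.map σ)ᵀ * H * T.val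
    have e1 : T.val * (T⁻¹ * γ * T).val = γ.val * T.val := by
      rw [Units.val_mul, Units.val_mul, ← Matrix.mul_assoc, ← Matrix.mul_assoc, ← Units.val_mul, mul_inv_cancel, Units.val_one, Matrix.one_mul]
    have e2 : ((T⁻¹ * γ * T).val.map σ)ᵀ * (T.val.map σ)ᵀ = (T.val.map σ)ᵀ * (γ.val.map σ)ᵀ := by
      rw [← Matrix.transpose_mul, ← Matrix.map_mul, e1, Matrix.map_mul, Matrix.transpose_mul]
    calc ((T⁻¹ * γ * T).val.map σ)ᵀ * ((T.val.map σ)ᵀ * H * T.val) * (T⁻¹ * γ * T).val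
        = ((T⁻¹ * γ * T).val.map σ)ᵀ * (T.val.map σ)ᵀ * H * (T.val * (T⁻¹ * γ * T).val) := by simp only [Matrix.mul_assoc]
      _ = (T.val.map σ)ᵀ * ((γ.val.map σ)ᵀ * H * γ.val) * T.val := by rw [e2, e1]; simp only [Matrix.mul_assoc]
      _ = (T.val.map σ)ᵀ * H * T.val := by rw [hγ]
  · rw [Units.val_mul, Units.val_mul, Matrix.coe_units_inv, Matrix.charpoly_units_conj']

end Congr

section Local

variable {F : Type} (E : Type) [Field F] [NumberField F] [Field E] [NumberField E] [Algebra F E]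
  [Algebra.IsQuadraticExtension F E] (v : HeightOneSpectrum (𝓞 F)) (c : E ≃ₐ[F] E) {δ : E} (hcδ : c δ = -δ) (hδ : δ ≠ 0)

include hcδ hδ in
/-- `δ² ∈ F` for `c δ = −δ ≠ 0` (private copy of the lemma of ★ `QuadraticLocalNormGroupNonsplit`). [folklore] -/
private theorem exists_delta_mul_self_eq_algebraMap_occ : ∃ d : F, δ * δ = algebraMap F E d := by
  obtain ⟨x, y, hxy⟩ := exists_eq_add_mul_of_isQuadraticExtension (F := F) (E := E)
    (not_mem_range_algebraMap_of_apply_eq_neg E c hcδ hδ) (δ * δ)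
  have hc2 : c (δ * δ) = δ * δ := by rw [map_mul, hcδ, neg_mul_neg]
  have hy : algebraMap F E y * δ = 0 := by
    have h1 : c (δ * δ) = algebraMap F E x - algebraMap F E y * δ := by
      rw [hxy, map_add, map_mul, AlgEquiv.commutes, AlgEquiv.commutes, hcδ, mul_neg, sub_eq_add_neg]
    rw [hc2, hxy] at h1
    have h2 : (2 : E) * (algebraMap F E y * δ) = 0 := by linear_combination h1
    exact (mul_eq_zero.1 h2).resolve_left two_ne_zero
  exact ⟨x, by rw [hxy, hy, add_zero]⟩

/-- The determinant of a `σ`-hermitian matrix is `σ`-fixed. [folklore] -/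
private theorem map_det_of_hermitian {K : Type*} [CommRing K] (σ : K →+* K) {n : Type*} [Fintype n] [DecidableEq n] {H : Matrix n n K}
    (hH : (H.map σ)ᵀ = H) : σ H.det = H.det := by
  conv_rhs => rw [← hH]
  rw [Matrix.det_transpose, ← RingHom.mapMatrix_apply, ← RingHom.map_det]

include hcδ hδ in
/-- **OCCURRENCE FROM A NON-NORM CARTAN ELEMENT** (rank 2, non-split `v`): `γ ∈ U(H)(F_v)` and `x ∈ Z(γ)` `⋆`-symmetric with unit determinant NOT a norm ⟹ for EVERY
`σ`-hermitian `G ∈ M₂(E_v)` with unit determinant some `B ∈ U(G)(F_v)` has `χ_B = χ_γ`.  Either `det G ≡ det H` and `G = ᵗσ(T) H T` (Jacobowitz), or `det G ≡ det(H x)`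
(index two) and `γ ∈ U(H x)`; then `B = T⁻¹ γ T`. [cite: Rogawski1990, §3.5 Prop. 3.5.2 (a)(c) p. 29; §14.1 p. 232] [cite: Jacobowitz1962, §3 Thm. 3.1] -/
theorem exists_mem_unitaryGroup_charpoly_eq_of_cartan (w : PlacesOver E v) (hw : c • w.1 = w.1)
    {H G : Matrix (Fin 2) (Fin 2) (LocalRing E v)} (hH : (H.map (conjLocal E c v))ᵀ = H) (hHd : IsUnit H.det) (hG : (G.map (conjLocal E c v))ᵀ = G) (hGd : IsUnit G.det)
    {γ : GL (Fin 2) (LocalRing E v)} (hγ : γ ∈ unitaryGroup (conjLocal E c v) H) {x : Matrix (Fin 2) (Fin 2) (LocalRing E v)} (hxγ : Commute x γ.val)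
    (hxs : hermStar (conjLocal E c v) H x = x) (hxd : IsUnit x.det) (hxn : ¬ ∃ z : LocalRing E v, IsUnit z ∧ x.det = conjLocal E c v z * z) :
    ∃ B : GL (Fin 2) (LocalRing E v), B ∈ unitaryGroup (conjLocal E c v) G ∧ B.val.charpoly = γ.val.charpoly := by
  letI : Field (LocalRing E v) := (Liu2021.LemD1IndexedNonVacuityNonsplitPlace.isField_localRing_of_nonsplit E v c hcδ hδ w hw).toField
  set σ := conjLocal E c v with hσdef
  -- the ratio of determinants `a = det G ∕ det H`, a `σ`-fixed unit
  set a : LocalRing E v := G.det * ↑(hHd.unit⁻¹) with ha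
  have hGa : G.det = H.det * a := by rw [ha, mul_left_comm, hHd.mul_val_inv, mul_one]
  have haσ : σ a = a := by
    have h : σ G.det = G.det := map_det_of_hermitian σ hG
    rw [hGa, map_mul, map_det_of_hermitian σ hH] at h
    exact hHd.mul_left_cancel h
  have hau : IsUnit a := hGd.mul (hHd.unit⁻¹).isUnit
  by_cases hn : ∃ z : LocalRing E v, IsUnit z ∧ a = σ z * z
  · -- `det G ≡ det H`: conjugate the form
    obtain ⟨z, hz, hz'⟩ := hn
    obtain ⟨T, hT⟩ := exists_formCongr_eq_of_det_eq_mul_norm E v c hcδ hδ w hw hH hG hHd hGd ⟨z, hz, by rw [hGa, hz']⟩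
    exact exists_mem_unitaryGroup_charpoly_eq_of_formCongr σ hT hγ
  · -- `det G ≡ det (H x)`: twist the form by the Cartan element `x`
    have hHx : ((H * x).map σ)ᵀ = H * x := (conjTranspose_mul_eq_self_iff σ H hH hHd x).2 hxs
    have hHxd : IsUnit (H * x).det := by rw [Matrix.det_mul]; exact hHd.mul hxd
    have hγx : γ ∈ unitaryGroup σ (H * x) := mem_unitaryGroup_mul_of_commute σ hγ hxγ.symm
    have hxσ : σ x.det = x.det := by
      have h := map_det_of_hermitian σ hHx
      rw [Matrix.det_mul, map_mul, map_det_of_hermitian σ hH] at h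
      exact hHd.mul_left_cancel h
    obtain ⟨z, hz, hz'⟩ := exists_norm_mul_of_not_exists_norm E v c hcδ hδ w hw hxσ hxd haσ hau hxn hn
    obtain ⟨T, hT⟩ := exists_formCongr_eq_of_det_eq_mul_norm E v c hcδ hδ w hw hHx hG hHxd hGd
      ⟨z, hz, by rw [hGa, hz', Matrix.det_mul, mul_comm (σ z * z) x.det, mul_assoc]⟩
    exact exists_mem_unitaryGroup_charpoly_eq_of_formCongr σ hT hγx

/-- `det (P · diag(d) · P⁻¹) = ∏ dᵢ`. [folklore] -/
private theorem det_eigenframe_diagonal_occ {K : Type*} [Field K] {n : Type*} [Fintype n] [DecidableEq n] (P : GL n K) (d : n → K) :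
    (P.val * diagonal d * (P⁻¹).val).det = ∏ i, d i := by
  rw [Matrix.det_mul, Matrix.det_mul, det_diagonal, mul_comm, ← mul_assoc, ← Matrix.det_mul, ← Units.val_mul, inv_mul_cancel, Units.val_one,
    Matrix.det_one, one_mul]

include hcδ hδ in
/-- **AN ELLIPTIC TYPE-(1) CLASS OCCURS IN EVERY BINARY FORM** (non-split `v`): `γ ∈ U(H)(F_v)` with eigenframe `γ P = P · diag(u)`, `u₀ ≠ u₁`, `σ(uᵢ) uᵢ = 1` ⟹ for every
`σ`-hermitian `G ∈ M₂(E_v)` with unit determinant some `B ∈ U(G)(F_v)` has `χ_B = χ_γ` — the Cartan element `P · diag(r₀, 1) · P⁻¹`, `r₀` a non-norm `σ`-fixed unit.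
[cite: Rogawski1990, §3.5 Prop. 3.5.2 (a)(c) p. 29; §3.6 p. 31; §14.1 p. 232] [cite: Kottwitz1986, §7] -/
theorem exists_mem_unitaryGroup_charpoly_eq_of_eigenframe (w : PlacesOver E v) (hw : c • w.1 = w.1)
    {H G : Matrix (Fin 2) (Fin 2) (LocalRing E v)} (hH : (H.map (conjLocal E c v))ᵀ = H) (hHd : IsUnit H.det) (hG : (G.map (conjLocal E c v))ᵀ = G) (hGd : IsUnit G.det)
    {γ : GL (Fin 2) (LocalRing E v)} (hγ : γ ∈ unitaryGroup (conjLocal E c v) H) {P : GL (Fin 2) (LocalRing E v)} {u : Fin 2 → LocalRing E v}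
    (hP : γ.val * P.val = P.val * diagonal u) (hu : Function.Injective u) (hu1 : ∀ i, conjLocal E c v (u i) * u i = 1) :
    ∃ B : GL (Fin 2) (LocalRing E v), B ∈ unitaryGroup (conjLocal E c v) G ∧ B.val.charpoly = γ.val.charpoly := by
  letI : Field (LocalRing E v) := (Liu2021.LemD1IndexedNonVacuityNonsplitPlace.isField_localRing_of_nonsplit E v c hcδ hδ w hw).toField
  obtain ⟨r₀, hr₀σ, hr₀u, hr₀n⟩ := exists_conjLocal_eq_not_exists_norm E v c hcδ hδ w hw
  set r : Fin 2 → LocalRing E v := ![r₀, 1] with hr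
  have hσr : ∀ i, conjLocal E c v (r i) = r i := by
    intro i; fin_cases i
    · exact hr₀σ
    · exact map_one _
  set x : Matrix (Fin 2) (Fin 2) (LocalRing E v) := P.val * diagonal r * (P⁻¹).val with hxdef
  have hxγ : Commute x γ.val := commute_eigenframe_diagonal hP r
  have hxs : hermStar (conjLocal E c v) H x = x := (hermStar_eigenframe_diagonal_eq_self_iff (conjLocal E c v) H hHd.ne_zero hγ hP hu hu1 r).2 hσr
  have hxdet : x.det = r₀ := by
    rw [hxdef, det_eigenframe_diagonal_occ, Fin.prod_univ_two]
    simp [hr]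
  have hxd : IsUnit x.det := by rw [hxdet]; exact hr₀u
  have hxn : ¬ ∃ z : LocalRing E v, IsUnit z ∧ x.det = conjLocal E c v z * z := by rw [hxdet]; exact hr₀n
  exact exists_mem_unitaryGroup_charpoly_eq_of_cartan E v c hcδ hδ w hw hH hHd hG hGd hγ hxγ hxs hxd hxn

include hcδ hδ in
/-- **AN ELLIPTIC TYPE-(2) CLASS OCCURS IN EVERY BINARY FORM** (non-split `v`): `γ ∈ U(H)(F_v)` whose characteristic polynomial has NO ROOT in `E_v` ⟹ for every
`σ`-hermitian `G ∈ M₂(E_v)` with unit determinant some `B ∈ U(G)(F_v)` has `χ_B = χ_γ` — the Cartan element is ★ (N1)'s `⋆`-symmetric `α + βγ` with non-norm determinant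
(`H¹(F_v, T_K) → F_v^×∕N E_v^×` is onto). [cite: Rogawski1990, §3.5 Prop. 3.5.2 (a)(c) p. 29; §3.6 p. 31; §14.1 p. 232] [cite: Kottwitz1986, §7] -/
theorem exists_mem_unitaryGroup_charpoly_eq_of_forall_eval_ne_zero (w : PlacesOver E v) (hw : c • w.1 = w.1)
    {H G : Matrix (Fin 2) (Fin 2) (LocalRing E v)} (hH : (H.map (conjLocal E c v))ᵀ = H) (hHd : IsUnit H.det) (hG : (G.map (conjLocal E c v))ᵀ = G) (hGd : IsUnit G.det)
    {γ : GL (Fin 2) (LocalRing E v)} (hγ : γ ∈ unitaryGroup (conjLocal E c v) H) (hA : ∀ r : LocalRing E v, γ.val.charpoly.eval r ≠ 0) :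
    ∃ B : GL (Fin 2) (LocalRing E v), B ∈ unitaryGroup (conjLocal E c v) G ∧ B.val.charpoly = γ.val.charpoly := by
  letI : Field (LocalRing E v) := (Liu2021.LemD1IndexedNonVacuityNonsplitPlace.isField_localRing_of_nonsplit E v c hcδ hδ w hw).toField
  obtain ⟨d, hd⟩ := exists_delta_mul_self_eq_algebraMap_occ E c hcδ hδ
  have hAu : (γ.val.map (conjLocal E c v))ᵀ * H * γ.val = H := (mem_unitaryGroup_iff (σ := conjLocal E c v) (H := H) (g := γ)).1 hγ
  obtain ⟨α, β, hxs, hxd, hxn⟩ := exists_hermStar_eq_self_det_not_norm E v c hcδ hδ hd w hw hH hHd hAu hA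
  exact exists_mem_unitaryGroup_charpoly_eq_of_cartan E v c hcδ hδ w hw hH hHd hG hGd hγ (commute_smul_one_add_smul γ.val α β) hxs hxd hxn

end Local

/-! ## §3 The classes with a given separable characteristic polynomial form a local stable class -/

section ClassSet

variable {F : Type} (E : Type) [Field F] [NumberField F] [Field E] [NumberField E] [Algebra F E] (v : HeightOneSpectrum (𝓞 F)) (c : E ≃ₐ[F] E)
  {m : ℕ} (G : Matrix (Fin m) (Fin m) (LocalRing E v))

/-- **Stably conjugate ⟺ same characteristic polynomial** (separable case) in `U(G)(F_v) ⊂ GL_m(E_v)`, `E_v = Π_{w ∣ v} E_w`: (→) conjugate matrices; (←) ★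
`exists_units_conj_eq_of_charpoly_eq_of_separable` place by place. [cite: Rogawski1990, §3.1 p. 19] -/
theorem isStablyConj_iff_charpoly_eq_of_separable (γ δ' : unitaryGroup (conjLocal E c v) G) (hsep : γ.val.val.charpoly.Separable) :
    IsStablyConj (conjLocal E c v) G γ δ' ↔ δ'.val.val.charpoly = γ.val.val.charpoly := by
  constructor
  · intro h
    obtain ⟨g, hg⟩ := isStablyConj_iff.1 h
    rw [← hg, Units.val_mul, Units.val_mul, Matrix.coe_units_inv, Matrix.charpoly_units_conj]
  · intro h
    obtain ⟨g, hg⟩ := exists_units_conj_eq_of_charpoly_eq_of_separable (K := fun w : PlacesOver E v => w.1.adicCompletion E) γ.val δ'.val hsep h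
    exact isStablyConj_iff.2 ⟨g, hg⟩

/-- **The interface set `S(G, γ)` IS the local class set**: `{⟦δ⟧ : χ_δ = χ_γ} = conjClassesIn σ G γ` for `γ ∈ U(G)(F_v)` with separable characteristic polynomial.
[cite: Rogawski1990, §4.1 (4.1.1) p. 39; §3.1 p. 19] -/
theorem setOf_charpoly_out_eq_eq_conjClassesIn (γ : unitaryGroup (conjLocal E c v) G) (hsep : γ.val.val.charpoly.Separable) :
    {b : ConjClasses (unitaryGroup (conjLocal E c v) G) | (Quotient.out b).val.val.charpoly = γ.val.val.charpoly} = conjClassesIn (conjLocal E c v) G γ := by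
  ext b
  rw [Set.mem_setOf_eq]
  conv_rhs => rw [← Quotient.out_eq b]
  show _ ↔ ConjClasses.mk (Quotient.out b) ∈ conjClassesIn (conjLocal E c v) G γ
  rw [mk_mem_conjClassesIn_iff, isStablyConj_iff_charpoly_eq_of_separable E v c G γ _ hsep]

/-- Hence, for `δ ∈ U(G)(F_v)` with `χ_δ = χ_γ` (separable): `S(G, γ) = conjClassesIn σ G δ` — the class set read at ANY of its members (so that the rank-2 counts ★
`ncard_conjClassesIn_eq_two_rankTwo` ∕ ★ `ncard_conjClassesIn_eq_one_of_irreducible_rankTwo` apply to `S(G, γ)` through an occurring `B`).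
[cite: Rogawski1990, §4.1 (4.1.1) p. 39] -/
theorem setOf_charpoly_out_eq_eq_conjClassesIn_of_charpoly_eq (p : (LocalRing E v)[X]) (hsep : p.Separable) (B : unitaryGroup (conjLocal E c v) G)
    (hB : B.val.val.charpoly = p) :
    {b : ConjClasses (unitaryGroup (conjLocal E c v) G) | (Quotient.out b).val.val.charpoly = p} = conjClassesIn (conjLocal E c v) G B := by
  subst hB
  exact setOf_charpoly_out_eq_eq_conjClassesIn E v c G B hsep

/-- When NO element of `U(G)(F_v)` has characteristic polynomial `p`, the interface set is EMPTY. [cite: Rogawski1990, §4.1 (4.1.1) p. 39] -/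
theorem setOf_charpoly_out_eq_eq_empty (p : (LocalRing E v)[X]) (hno : ∀ B : unitaryGroup (conjLocal E c v) G, B.val.val.charpoly ≠ p) :
    {b : ConjClasses (unitaryGroup (conjLocal E c v) G) | (Quotient.out b).val.val.charpoly = p} = ∅ :=
  Set.eq_empty_of_forall_notMem fun _ hb => hno _ hb

end ClassSet

end Literature.NumberTheory.Rogawski1990

end
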